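import Summits.AtomisticToContinuum.Crystallization.Theorems.ChargedEnergyGapSelfCharge
import HarnessLib

/-!
# Charged energy gap — lens-3 g63, part P-Z₅⁰: the bulk residual WITH THE PHYSICAL HYPOTHESES of (H𝄪ˢ)

Cell `decomp-a2c`, seat lens-3, generation 63, part P-Z₅⁰ (after P-Z₃ `ChargedEnergyGapSelfCharge`).  ELEMENTARY·PROVED (glue only).
P-X ⟶ P-Y ⟶ P-Z₃ reduced the rotation sub-family `RotationFamilyS` of the 14231 record designate (H𝄪ˢ) to the PURELY GEOMETRIC residual
`BulkFarResidueBound s lam ℓ ϱ ϱχ B_T B_χ B_H` (record `(1/2100, 1/46)`, `B_H` free), whose hypotheses are separation, labelling and the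
invariance of the sets — but NOT the three physical hypotheses `IsForceFree P`, `IsSiteStressFree P`, `HarmStableModRot μ₀ P` that every
instance of (H𝄪ˢ) carries (P-X's glue `rotationFamilyS_of_excisionCharging` discards them).  The seat's feasibility audit (HANDOFF §J) shows
that the geometric residual must then survive a density contrast of ≈ 11 : 1 across the crossing surface (labelling-admissible, physically
absurd), where the carrier budget `B_T = 1/2100` is met only by the most expensive counting; whereas site-stress-freeness pins the local spacing
near the Lennard-Jones minimum (the trace of the site virial is `Σ_z (d_z⁻⁶ − d_z⁻¹²) = 0`, §J (J6)).  This file RE-THREADS the physical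
hypotheses through the residual, at zero cost to the node:
* `BulkFarResidueBoundSF s lam ℓ μ₀ ϱ ϱχ B_T B_χ B_H` — the bulk far-residue bound demanded only of force-free, site-stress-free, harmonically
  stable (mod rotations, modulus `μ₀`) references; `bulkFarResidueBoundSF_of_bulk` — the geometric bound implies it;
* ★★ `rotationFamilyS_of_bulkSF` — the whole chain P-X/P-Y/P-Z₃ redone POINTWISE in the instance: `BulkFarResidueBoundSF … B_T B_χ B_H`,
  a tail constant `κ ≥ (2h/s+2)(2/s)²((3ϱ/8+h+s/2)/(3ϱ/8))²(3/(3ϱ/8)⁴ + 1/(h(3ϱ/8)³))` and budgets `λτ²(B_T+κ) ≤ C_T`, `λτ²(B_χ+κ) ≤ Cχ`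
  give `RotationFamilyS s lam ℓ μ₀ τ λ ϱ b₀ r_S C_T ϱχ Cχ` with `C_H := λτ²(B_H + 1024/s³)`;
* ★ `rotationFamilyS_record_of_bulkBoundSF` — at the record dials `BulkFarResidueBoundSF (3/5) (1/3) 3 (1/100) 160 80 (1/2100) (1/46)
  B_H` (any `B_H ≥ 0`) gives `RotationFamilyS (3/5) (1/3) 3 (1/100) (3/100) (1/2) 160 (2/5) 3 (1/3000000) 80 (1/100000)`.
So g64 may prove the residual under `IsSiteStressFree` (local spacing window ⇒ density contrast ≤ ≈ 2.6 : 0.45, §J (V2)) without touching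
the node's conclusion.
-/

noncomputable section

open scoped Classical

open Literature.MathematicalPhysics.StatisticalMechanics Literature.Geometry.DiscreteGeometry
open Summit.AtomisticToContinuum.Crystallization.Theses.PricedLinkCensus
open Summit.AtomisticToContinuum.Crystallization.Theorems.ChargedEnergyGapNegative

namespace Summit.AtomisticToContinuum.Crystallization.Theorems.ChargedEnergyGapChartDial

section ResidualSF

variable (ϱχ ϱ : ℝ)

/-- piece BULK-FAR-RESIDUE-SF(`B_T`, `B_χ`, `B_H`) · UNDECIDED→TRUE-leaning at the record `(B_T, B_χ) = (1/2100, 1/46)`, `B_H` free ·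
ATTACKABLE·M.  **THE BULK FAR-RESIDUE BOUND UNDER THE PHYSICAL HYPOTHESES**: as `BulkFarResidueBound` (P-Z₃), but demanded only of references
that are force-free, SITE-stress-free and harmonically stable modulo rotations with modulus `μ₀` — exactly the hypotheses every instance of
(H𝄪ˢ) / `RotationFamilyS` carries.  Why it might fail / content: as for `BulkFarResidueBound` (segment charging through the boundary layer of
the paying region, HANDOFF §E/§I/§J), now with the density contrast across the crossing surface controlled by the vanishing site virials
(§J (J6)): the load per carrier `≈ π²r²/(9·(7ϱ/8)²)·ρ_bulk·ρ_far/k` must stay below `B_T` for a fair share over `k` carriers. -/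
def BulkFarResidueBoundSF (s lam ℓ μ₀ ϱ ϱχ B_T B_χ B_H : ℝ) : Prop :=
  ∀ (P : PeriodicConfiguration 3) (C X : Set E3) (m : ℕ) (D : Fin m → Set E3) (σ : Fin m → Bool),
    IsSeparatedRef s P → IsLabelledRef lam ℓ P → IsForceFree P → IsSiteStressFree P → HarmStableModRot μ₀ P →
    IsInvariantSet P C → IsInvariantSet P X → (∀ i, IsInvariantSet P (D i)) →
    bulkFarResidue ϱχ D σ P X ϱ C ≤
      B_T * shellMassL ϱχ D σ P X ϱ C + B_χ * transMassL ϱχ D σ P X ϱ C + B_H * (pricedNearCountL ϱχ D σ P X ϱ C : ℝ)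

variable {ϱχ ϱ} {s lam ℓ μ₀ τ lamQ b₀ r_S C_T Cχ : ℝ}

/-- The geometric bulk bound (P-Z₃) implies the physical one (the three extra hypotheses are discarded). [formal bookkeeping] -/
theorem bulkFarResidueBoundSF_of_bulk {B_T B_χ B_H : ℝ} (h : BulkFarResidueBound s lam ℓ ϱ ϱχ B_T B_χ B_H) :
    BulkFarResidueBoundSF s lam ℓ μ₀ ϱ ϱχ B_T B_χ B_H :=
  fun P C X m D σ hsep hlab _ _ _ hC hX hD => h P C X m D σ hsep hlab hC hX hD

/-- Larger constants give a weaker bound. [formal bookkeeping] -/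
theorem BulkFarResidueBoundSF.mono {B_T B_χ B_H B_T' B_χ' B_H' : ℝ} (hT : B_T ≤ B_T') (hχ : B_χ ≤ B_χ') (hH : B_H ≤ B_H')
    (h : BulkFarResidueBoundSF s lam ℓ μ₀ ϱ ϱχ B_T B_χ B_H) : BulkFarResidueBoundSF s lam ℓ μ₀ ϱ ϱχ B_T' B_χ' B_H' := by
  intro P C X m D σ hsep hlab hF hS hH' hC hX hD
  have h1 := h P C X m D σ hsep hlab hF hS hH' hC hX hD
  have h2 := mul_le_mul_of_nonneg_right hT (shellMassL_nonneg ϱχ D σ P X ϱ C)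
  have h3 := mul_le_mul_of_nonneg_right hχ (transMassL_nonneg ϱχ D σ P X ϱ C)
  have h4 := mul_le_mul_of_nonneg_right hH (Nat.cast_nonneg (pricedNearCountL ϱχ D σ P X ϱ C) : (0 : ℝ) ≤ _)
  linarith

/-- ★★ **THE ROTATION SUB-FAMILY FROM THE PHYSICAL BULK BOUND** — the chain P-X (`localS_conclusion_rotField_of_geomCharging`), P-Y
(`excisionMassL_le_near_add_far`), P-Z₃ (`farResidue_le_selfCharge`) redone pointwise in the instance, so that the instance's own
`IsForceFree`/`IsSiteStressFree`/`HarmStableModRot` feed the residual: for `0 < s ≤ 1`, `s ≤ 3ϱ/8`, `1 ≤ 3ϱ/8`, a shell thickness `h > 0`, a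
tail constant `κ` at least P-Z₂'s, `λ, τ, B_H ≥ 0` and budgets `λτ²(B_T+κ) ≤ C_T`, `λτ²(B_χ+κ) ≤ Cχ`:
`BulkFarResidueBoundSF s lam ℓ μ₀ ϱ ϱχ B_T B_χ B_H ⟹ RotationFamilyS s lam ℓ μ₀ τ λ ϱ b₀ r_S C_T ϱχ Cχ` (`C_H := λτ²(B_H + 1024/s³)`). -/
theorem rotationFamilyS_of_bulkSF {B_T B_χ B_H : ℝ} (hs : 0 < s) (hs1 : s ≤ 1) (hϱ1 : 1 ≤ 3 * ϱ / 8) (hsϱ : s ≤ 3 * ϱ / 8)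
    {h : ℝ} (hh : 0 < h) (hlam : 0 ≤ lamQ) (hτ : 0 ≤ τ) (hBH : 0 ≤ B_H) (hB : BulkFarResidueBoundSF s lam ℓ μ₀ ϱ ϱχ B_T B_χ B_H) (κ : ℝ)
    (hκ : (2 * h / s + 2) * (2 / s) ^ 2 * ((3 * ϱ / 8 + h + s / 2) / (3 * ϱ / 8)) ^ 2 * (3 / (3 * ϱ / 8) ^ 4 + 1 / (h * (3 * ϱ / 8) ^ 3)) ≤ κ)
    (hT : lamQ * τ ^ 2 * (B_T + κ) ≤ C_T) (hχ : lamQ * τ ^ 2 * (B_χ + κ) ≤ Cχ) :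
    RotationFamilyS s lam ℓ μ₀ τ lamQ ϱ b₀ r_S C_T ϱχ Cχ := by
  refine ⟨lamQ * τ ^ 2 * (B_H + 1024 / s ^ 3), by positivity, ?_⟩
  intro P C X r₀ v S m D σ hsep hlab hF hS hH' hC hX _ _ hW hD
  refine localS_conclusion_rotField_of_geomCharging ϱχ D σ X ϱ C hS hlam hτ S hW hX ?_
  have h1 := excisionMassL_le_near_add_far ϱχ σ ϱ hsep hs hs1 hX hC hD
  have h2 := farResidue_le_selfCharge ϱχ D σ X ϱ C hsep hs hϱ1 hsϱ hh
  have h3 := hB P C X m D σ hsep hlab hF hS hH' hC hX hD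
  have hsh := shellMassL_nonneg ϱχ D σ P X ϱ C
  have htr := transMassL_nonneg ϱχ D σ P X ϱ C
  have hpr : (0 : ℝ) ≤ (pricedNearCountL ϱχ D σ P X ϱ C : ℝ) := Nat.cast_nonneg _
  have hlt : 0 ≤ lamQ * τ ^ 2 := by positivity
  have hκM := mul_le_mul_of_nonneg_right hκ (add_nonneg hsh htr)
  have hE : excisionMassL ϱχ D σ P X ϱ C ≤ (B_T + κ) * shellMassL ϱχ D σ P X ϱ C + (B_χ + κ) * transMassL ϱχ D σ P X ϱ C +
      (B_H + 1024 / s ^ 3) * (pricedNearCountL ϱχ D σ P X ϱ C : ℝ) := by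
    nlinarith
  have h4 := mul_le_mul_of_nonneg_left hE hlt
  have h5 := mul_le_mul_of_nonneg_right hT hsh
  have h6 := mul_le_mul_of_nonneg_right hχ htr
  nlinarith

/-- ★ **NODE 63″ — THE RECORD ROTATION SUB-FAMILY FROM THE PHYSICAL BULK BOUND**: `BulkFarResidueBoundSF (3/5) (1/3) 3 (1/100) 160 80 (1/2100)
(1/46) B_H` (any `B_H ≥ 0`) gives `RotationFamilyS (3/5) (1/3) 3 (1/100) (3/100) (1/2) 160 (2/5) 3 (1/3000000) 80 (1/100000)` (tail
`κ = 1/3800` at `h = 12/5`; `4.5·10⁻⁴·(1/2100 + 1/3800) ≤ 1/(3·10⁶)`, `4.5·10⁻⁴·(1/46 + 1/3800) ≤ 10⁻⁵`). -/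
theorem rotationFamilyS_record_of_bulkBoundSF {B_H : ℝ} (hBH : 0 ≤ B_H)
    (hB : BulkFarResidueBoundSF (3 / 5) (1 / 3) 3 (1 / 100) 160 80 (1 / 2100) (1 / 46) B_H) :
    RotationFamilyS (3 / 5) (1 / 3) 3 (1 / 100) (3 / 100) (1 / 2) 160 (2 / 5) 3 (1 / 3000000) 80 (1 / 100000) :=
  rotationFamilyS_of_bulkSF (by norm_num) (by norm_num) (by norm_num) (by norm_num) (h := 12 / 5) (by norm_num) (by norm_num) (by norm_num)
    hBH hB (1 / 3800) (by norm_num) (by norm_num) (by norm_num)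

/-- The geometric record bound still closes the node through the physical one (consistency with P-Z₃ `rotationFamilyS_record_of_bulkBound`). -/
theorem rotationFamilyS_record_of_bulkBound' {B_H : ℝ} (hBH : 0 ≤ B_H)
    (hB : BulkFarResidueBound (3 / 5) (1 / 3) 3 160 80 (1 / 2100) (1 / 46) B_H) :
    RotationFamilyS (3 / 5) (1 / 3) 3 (1 / 100) (3 / 100) (1 / 2) 160 (2 / 5) 3 (1 / 3000000) 80 (1 / 100000) :=
  rotationFamilyS_record_of_bulkBoundSF hBH (bulkFarResidueBoundSF_of_bulk hB)

/-- Record numerals of the physical chain: `λτ² = 4.5·10⁻⁴`, the two budgets with the tail `1/3800`, and `C_H`'s kernel share `32/15`. -/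
theorem record_bulkSF_numerals : (1 / 2 : ℝ) * (3 / 100) ^ 2 * (1 / 2100 + 1 / 3800) ≤ 1 / 3000000 ∧
    (1 / 2 : ℝ) * (3 / 100) ^ 2 * (1 / 46 + 1 / 3800) ≤ 1 / 100000 ∧ (1 / 2 : ℝ) * (3 / 100) ^ 2 * (1024 / (3 / 5) ^ 3) = 32 / 15 := by
  refine ⟨by norm_num, by norm_num, by norm_num⟩

end ResidualSF

end Summit.AtomisticToContinuum.Crystallization.Theorems.ChargedEnergyGapChartDial

end
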